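import Summits.HodgeConjecture.CorCM.IrreducibleOddWeightsIsotypicComponents
import HarnessLib

/-!
# Isotypic cells, existence IX: PARITY — under a central involution `ρ` every irreducible constituent is EVEN or
# ODD, the components of an odd vector are odd (and vanish in the even classes), and the odd weights are the direct
# sum of the odd isotypic components: `dim Anti(Y₀) = Σ_{c odd} m_c·dim A_c`

COR-CM (cell `pub-hodgecm2`, binder seat `b16` gen 76, count-neutral claim THE ISOTYPIC DECOMPOSITION EXISTS, file
E9 — abstract `G`-set level; theorems only, no definition, no named fact, no `sorry`).  NEW as organised here, hence
under `Summits/`.  HONEST FRAMING: a CM slot carries a distinguished `ρ ∈ G` (complex conjugation) commuting with the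
action and acting as a fixed-point-free involution; the type vector `u = antiVec Φ 1` is ODD (`u(ρy) = −u(y)`, tree
`antiWeights`).  This file sorts the isotypic decomposition of E3/E8 by PARITY, preparing the class-by-class
nondegeneracy criterion of file E10.  Nothing about Hodge classes is asserted; `HC_CM` is neither used nor asserted.

SETTING: `ρ ∈ G` with `g·ρ·y = ρ·g·y` and `ρ·ρ·y = y` on the pivots concerned; `Sym = symWeights ρ`
(`f(ρy) = f(y)`), `Anti = antiWeights ρ` (`f(ρy) = −f(y)`) — tree `Literature/…/CMTypeRank`.

* §1 `mem_symWeights_iff'`, `comp_smul_mem_symWeights` (`Sym` is stable), **`le_symWeights_or_le_antiWeights`**: a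
  stable IRREDUCIBLE `A` is EVEN (`A ≤ Sym`) or ODD (`A ≤ Anti`) — `A ⊓ Sym` and `A ⊓ Anti` are stable, and
  `a + a(ρ·) ∈ A ⊓ Sym`.
* §2 TRANSPORT: `map_mem_antiWeights` / `map_mem_symWeights` (an equivariant `ι` carries odd to odd and even to even).
* §3 **THE COMPONENTS OF AN ODD VECTOR ARE ODD** (`mem_antiWeights_of_components`): for `u = Σ_c Σ_j ι_{c,j}(b_{c,j})`
  odd with jointly independent class parts (gen 75 M1), every `b_{c,j}` is odd; so **the components in the EVEN
  classes VANISH** (`eq_zero_of_le_symWeights`).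
* §4 **`Anti(Y₀) = ⨆_{c odd} ⨆_j ι_{c,j}(A_c)`** (`antiWeights_eq_iSup_odd`) when the images span `ℚ^{Y₀}`, and
  **`dim Anti(Y₀) = Σ_{c odd} |J_c|·dim A_c`** (`finrank_antiWeights_eq_sum_odd`).

## References

* [Serre1977] J.-P. Serre, *Linear Representations of Finite Groups*, GTM 42, §2.2 (Schur: a central element acts
  by a scalar on an irreducible), §2.6.
* [Kubota1965] T. Kubota, *On the field extension by complex multiplication*, Trans. AMS 118 (1965), §2 (the
  anti-invariant part).
* [Deligne1982HodgeCycles] P. Deligne, *Hodge cycles on abelian varieties*, LNM 900 (1982), I Ex. 3.7.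
-/

set_option autoImplicit false

noncomputable section

open scoped BigOperators Classical

universe uC uJ v' vA vC w

namespace Summit.HodgeConjecture.CorCM.IrrOdd

open Literature.NumberTheory.ComplexMultiplication

variable {G : Type w} [Group G] {ρ : G}

/-! ### §1 Parity of an irreducible -/

section Parity

variable {Y : Type vA} [MulAction G Y]

/-- Membership in the `ρ`-even weights `f(ρy) = f(y)`. [folklore] -/
theorem mem_symWeights_iff' {f : Y → ℚ} : f ∈ symWeights (E := Y) ρ ↔ ∀ y, f (ρ • y) = f y :=
  Iff.rfl

/-- `Sym` is stable under the translates when `ρ` commutes with the action. [folklore] -/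
theorem comp_smul_mem_symWeights (hcomm : ∀ (g : G) (y : Y), g • ρ • y = ρ • g • y) (k : G) (a : Y → ℚ)
    (ha : a ∈ symWeights (E := Y) ρ) : (fun y => a (k • y)) ∈ symWeights (E := Y) ρ := fun y => by
  change a (k • ρ • y) = a (k • y)
  rw [hcomm]
  exact ha _

/-- **A STABLE IRREDUCIBLE IS EVEN OR ODD**: for `ρ ∈ G` commuting with the action and involutive on `Y`, a stable
irreducible `A ≤ ℚ^Y` satisfies `A ≤ Sym` or `A ≤ Anti` (`A ⊓ Sym`, `A ⊓ Anti` are stable; if both vanish then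
`a + a(ρ·) ∈ A ⊓ Sym = 0` puts `A` inside `Anti`). [cite: Serre1977, §2.2] [cite: Kubota1965, §2 (p. 115)] -/
theorem le_symWeights_or_le_antiWeights (hcomm : ∀ (g : G) (y : Y), g • ρ • y = ρ • g • y)
    (hinv : ∀ y : Y, ρ • ρ • y = y) {A : Submodule ℚ (Y → ℚ)}
    (hAst : ∀ (k : G) (a : Y → ℚ), a ∈ A → (fun y => a (k • y)) ∈ A)
    (hAirr : ∀ W : Submodule ℚ (Y → ℚ), W ≤ A → W ≠ ⊥ →
      (∀ (k : G) (f : Y → ℚ), f ∈ W → (fun y => f (k • y)) ∈ W) → W = A) :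
    A ≤ symWeights (E := Y) ρ ∨ A ≤ antiWeights (E := Y) ρ := by
  by_cases hS : A ⊓ symWeights (E := Y) ρ = ⊥
  · right
    by_cases hT : A ⊓ antiWeights (E := Y) ρ = ⊥
    · -- both parts vanish: every `a + a(ρ·)` is zero, so `A ≤ Anti` (indeed `A = 0`)
      intro a ha
      have hsum : a + (fun y => a (ρ • y)) ∈ A ⊓ symWeights (E := Y) ρ := by
        refine Submodule.mem_inf.2 ⟨A.add_mem ha (hAst ρ a ha), fun y => ?_⟩
        simp only [Pi.add_apply, hinv, add_comm]
      rw [hS, Submodule.mem_bot] at hsum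
      rw [mem_antiWeights_iff']
      intro y
      have h := congrFun hsum y
      simp only [Pi.add_apply, Pi.zero_apply] at h
      linarith
    · exact inf_eq_left.1 (hAirr _ inf_le_left hT fun k f hf =>
        Submodule.mem_inf.2 ⟨hAst k f hf.1, comp_smul_mem_antiWeights hcomm k f hf.2⟩)
  · left
    exact inf_eq_left.1 (hAirr _ inf_le_left hS fun k f hf =>
      Submodule.mem_inf.2 ⟨hAst k f hf.1, comp_smul_mem_symWeights hcomm k f hf.2⟩)

end Parity

/-! ### §2 Transport of parity along equivariant maps -/

section Transport

variable {Y₀ : Type v'} [MulAction G Y₀] {YA : Type vA} [MulAction G YA]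

/-- An equivariant `ι` carries ODD elements of `A` to odd functions. [cite: Kubota1965, §2 (p. 115)] -/
theorem map_mem_antiWeights {A : Submodule ℚ (YA → ℚ)} (ι : (YA → ℚ) →ₗ[ℚ] (Y₀ → ℚ))
    (hιeq : ∀ (k : G) (a : YA → ℚ), a ∈ A → ι (fun y => a (k • y)) = fun y => ι a (k • y))
    {a : YA → ℚ} (ha : a ∈ A) (hodd : a ∈ antiWeights (E := YA) ρ) : ι a ∈ antiWeights (E := Y₀) ρ := by
  rw [mem_antiWeights_iff']
  intro y
  have h1 : (fun y => a (ρ • y)) = -a := funext fun y => by rw [Pi.neg_apply]; exact hodd y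
  have h2 := hιeq ρ a ha
  rw [h1, map_neg] at h2
  have h3 := congrFun h2 y
  rw [Pi.neg_apply] at h3
  exact h3.symm

/-- An equivariant `ι` carries EVEN elements of `A` to even functions. [folklore] -/
theorem map_mem_symWeights {A : Submodule ℚ (YA → ℚ)} (ι : (YA → ℚ) →ₗ[ℚ] (Y₀ → ℚ))
    (hιeq : ∀ (k : G) (a : YA → ℚ), a ∈ A → ι (fun y => a (k • y)) = fun y => ι a (k • y))
    {a : YA → ℚ} (ha : a ∈ A) (heven : a ∈ symWeights (E := YA) ρ) : ι a ∈ symWeights (E := Y₀) ρ := by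
  rw [mem_symWeights_iff']
  intro y
  have h1 : (fun y => a (ρ • y)) = a := funext fun y => heven y
  have h2 := hιeq ρ a ha
  rw [h1] at h2
  exact (congrFun h2 y).symm

omit [MulAction G Y₀] in
/-- An element that is both even and odd is zero. [folklore] -/
theorem eq_zero_of_mem_symWeights_of_mem_antiWeights {a : YA → ℚ} (heven : a ∈ symWeights (E := YA) ρ)
    (hodd : a ∈ antiWeights (E := YA) ρ) : a = 0 := by
  funext y
  have h1 := heven y
  have h2 := hodd y
  rw [Pi.zero_apply]
  linarith

end Transport

/-! ### §3 The components of an odd vector are odd -/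

section Components

variable {Y₀ : Type v'} [MulAction G Y₀] {C : Type uC} [Fintype C] {Yc : C → Type vC} [∀ c, MulAction G (Yc c)]
  [∀ c, Fintype (Yc c)] {Ar : ∀ c, Submodule ℚ (Yc c → ℚ)} {JJ : C → Type uJ} [∀ c, Fintype (JJ c)]

/-- **THE COMPONENTS OF AN ODD VECTOR ARE ODD.**  References `A_c` stable irreducible pairwise non-embeddable,
embeddings `ι_{c,j}` equivariant and jointly independent on `A_c`, `u = Σ_c Σ_j ι_{c,j}(b_{c,j})` with `b_{c,j} ∈ A_c`.
If `u` is odd then every `b_{c,j}` is odd: `Σ_{c,j} ι_{c,j}(b_{c,j} + b_{c,j}(ρ·)) = u + u(ρ·) = 0`, and the class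
parts are jointly independent (gen 75 M1). [cite: Serre1977, §2.6] [cite: Kubota1965, §2 (p. 115)] -/
theorem mem_antiWeights_of_components
    (hRst : ∀ c (k : G) (a : Yc c → ℚ), a ∈ Ar c → (fun y => a (k • y)) ∈ Ar c)
    (hRirr : ∀ c (W : Submodule ℚ (Yc c → ℚ)), W ≤ Ar c → W ≠ ⊥ →
      (∀ (k : G) (f : Yc c → ℚ), f ∈ W → (fun y => f (k • y)) ∈ W) → W = Ar c)
    (hsep : ∀ c c' (L : (Yc c → ℚ) →ₗ[ℚ] (Yc c' → ℚ)), c ≠ c' → Ar c ≠ ⊥ → (∀ a ∈ Ar c, L a ∈ Ar c') →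
      (∀ a ∈ Ar c, L a = 0 → a = 0) →
      (∀ (k : G) (a : Yc c → ℚ), a ∈ Ar c → L (fun y => a (k • y)) = fun y => L a (k • y)) → False)
    (ι : ∀ c, JJ c → ((Yc c → ℚ) →ₗ[ℚ] (Y₀ → ℚ)))
    (hιeq : ∀ c (j : JJ c) (k : G) (a : Yc c → ℚ), a ∈ Ar c →
      ι c j (fun y => a (k • y)) = fun y => ι c j a (k • y))
    (hind : ∀ c (f : JJ c → (Yc c → ℚ)), (∀ j, f j ∈ Ar c) → ∑ j, ι c j (f j) = 0 → ∀ j, f j = 0)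
    {b : ∀ c, JJ c → (Yc c → ℚ)} (hb : ∀ c j, b c j ∈ Ar c)
    (hodd : (∑ c, ∑ j, ι c j (b c j)) ∈ antiWeights (E := Y₀) ρ) (c : C) (j : JJ c) :
    b c j ∈ antiWeights (E := Yc c) ρ := by
  -- `f p = b_p + b_p(ρ·)` has `Σ_p ι_p(f p) = u + u(ρ·) = 0`
  have h0 : ∑ p : Σ c, JJ c, ι p.1 p.2 (b p.1 p.2 + fun y => b p.1 p.2 (ρ • y)) = 0 := by
    have hsplit : ∑ p : Σ c, JJ c, ι p.1 p.2 (b p.1 p.2 + fun y => b p.1 p.2 (ρ • y)) =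
        (∑ c, ∑ j, ι c j (b c j)) + fun y => (∑ c, ∑ j, ι c j (b c j)) (ρ • y) := by
      rw [Fintype.sum_sigma]
      have h2 : (fun y => (∑ c, ∑ j, ι c j (b c j)) (ρ • y)) = ∑ c, ∑ j, ι c j (fun y => b c j (ρ • y)) := by
        funext y
        simp only [Finset.sum_apply]
        exact Finset.sum_congr rfl fun c _ => Finset.sum_congr rfl fun j _ => by
          rw [hιeq c j ρ _ (hb c j)]
      rw [h2, ← Finset.sum_add_distrib]
      exact Finset.sum_congr rfl fun c _ => by
        rw [← Finset.sum_add_distrib]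
        exact Finset.sum_congr rfl fun j _ => by rw [map_add]
    rw [hsplit]
    funext y
    rw [Pi.add_apply, Pi.zero_apply, hodd y, add_neg_cancel]
  have h := jointly_independent_sigma_of_classes hRst hRirr hsep ι hιeq hind
    (fun p => b p.1 p.2 + fun y => b p.1 p.2 (ρ • y)) (fun p => (Ar p.1).add_mem (hb p.1 p.2) (hRst p.1 ρ _ (hb p.1 p.2)))
    h0 ⟨c, j⟩
  rw [mem_antiWeights_iff']
  intro y
  have h1 := congrFun h y
  simp only [Pi.add_apply, Pi.zero_apply] at h1
  linarith

/-- **THE COMPONENTS IN THE EVEN CLASSES VANISH**: with the data of `mem_antiWeights_of_components`, if `A_c ≤ Sym`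
then `b_{c,j} = 0` for all `j`. [cite: Serre1977, §2.2 and §2.6] -/
theorem eq_zero_of_le_symWeights
    (hRst : ∀ c (k : G) (a : Yc c → ℚ), a ∈ Ar c → (fun y => a (k • y)) ∈ Ar c)
    (hRirr : ∀ c (W : Submodule ℚ (Yc c → ℚ)), W ≤ Ar c → W ≠ ⊥ →
      (∀ (k : G) (f : Yc c → ℚ), f ∈ W → (fun y => f (k • y)) ∈ W) → W = Ar c)
    (hsep : ∀ c c' (L : (Yc c → ℚ) →ₗ[ℚ] (Yc c' → ℚ)), c ≠ c' → Ar c ≠ ⊥ → (∀ a ∈ Ar c, L a ∈ Ar c') →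
      (∀ a ∈ Ar c, L a = 0 → a = 0) →
      (∀ (k : G) (a : Yc c → ℚ), a ∈ Ar c → L (fun y => a (k • y)) = fun y => L a (k • y)) → False)
    (ι : ∀ c, JJ c → ((Yc c → ℚ) →ₗ[ℚ] (Y₀ → ℚ)))
    (hιeq : ∀ c (j : JJ c) (k : G) (a : Yc c → ℚ), a ∈ Ar c →
      ι c j (fun y => a (k • y)) = fun y => ι c j a (k • y))
    (hind : ∀ c (f : JJ c → (Yc c → ℚ)), (∀ j, f j ∈ Ar c) → ∑ j, ι c j (f j) = 0 → ∀ j, f j = 0)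
    {b : ∀ c, JJ c → (Yc c → ℚ)} (hb : ∀ c j, b c j ∈ Ar c)
    (hodd : (∑ c, ∑ j, ι c j (b c j)) ∈ antiWeights (E := Y₀) ρ) {c : C}
    (heven : Ar c ≤ symWeights (E := Yc c) ρ) (j : JJ c) : b c j = 0 :=
  eq_zero_of_mem_symWeights_of_mem_antiWeights (heven (hb c j))
    (mem_antiWeights_of_components hRst hRirr hsep ι hιeq hind hb hodd c j)

/-! ### §4 The odd weights are the direct sum of the odd isotypic components -/

variable [Fintype Y₀]

omit [∀ c, Fintype (Yc c)] [Fintype Y₀] in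
/-- **COMPONENTS ALONG A SPANNING FAMILY OF IMAGES**: if `⨆_{c,j} ι_{c,j}(A_c) = ℚ^{Y₀}` then every `u ∈ ℚ^{Y₀}` is
`Σ_c Σ_j ι_{c,j}(b_{c,j})` with `b_{c,j} ∈ A_c`. [folklore] -/
theorem exists_components_of_iSup_map_eq_top (ι : ∀ c, JJ c → ((Yc c → ℚ) →ₗ[ℚ] (Y₀ → ℚ)))
    (htop : (⨆ c, ⨆ j, (Ar c).map (ι c j)) = ⊤) (u : Y₀ → ℚ) :
    ∃ b : ∀ c, JJ c → (Yc c → ℚ), (∀ c j, b c j ∈ Ar c) ∧ u = ∑ c, ∑ j, ι c j (b c j) := by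
  have hu : u ∈ ⨆ q : Σ c, JJ c, (Ar q.1).map (ι q.1 q.2) := by
    rw [iSup_sigma, htop]
    exact Submodule.mem_top
  obtain ⟨f, hf, hfu⟩ := exists_sum_eq_of_mem_iSup hu
  choose a ha hfa using fun q => Submodule.mem_map.1 (hf q)
  refine ⟨fun c j => a ⟨c, j⟩, fun c j => ha ⟨c, j⟩, ?_⟩
  rw [← hfu, Fintype.sum_sigma]
  exact Finset.sum_congr rfl fun c _ => Finset.sum_congr rfl fun j _ => (hfa ⟨c, j⟩).symm

omit [Fintype Y₀] in
/-- **`Anti(Y₀) = ⨆_{c odd} ⨆_j ι_{c,j}(A_c)`**: when the images span `ℚ^{Y₀}` and `ρ` commutes with the action and is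
involutive on every reference pivot, the odd weights are the sum of the images of the ODD references (each
reference is even or odd, §1; odd components only, §3). [cite: Kubota1965, §2 (p. 115)] [cite: Serre1977, §2.6] -/
theorem antiWeights_eq_iSup_odd
    (hcomm : ∀ c (g : G) (y : Yc c), g • ρ • y = ρ • g • y) (hinv : ∀ c (y : Yc c), ρ • ρ • y = y)
    (hRst : ∀ c (k : G) (a : Yc c → ℚ), a ∈ Ar c → (fun y => a (k • y)) ∈ Ar c)
    (hRirr : ∀ c (W : Submodule ℚ (Yc c → ℚ)), W ≤ Ar c → W ≠ ⊥ →
      (∀ (k : G) (f : Yc c → ℚ), f ∈ W → (fun y => f (k • y)) ∈ W) → W = Ar c)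
    (hsep : ∀ c c' (L : (Yc c → ℚ) →ₗ[ℚ] (Yc c' → ℚ)), c ≠ c' → Ar c ≠ ⊥ → (∀ a ∈ Ar c, L a ∈ Ar c') →
      (∀ a ∈ Ar c, L a = 0 → a = 0) →
      (∀ (k : G) (a : Yc c → ℚ), a ∈ Ar c → L (fun y => a (k • y)) = fun y => L a (k • y)) → False)
    (ι : ∀ c, JJ c → ((Yc c → ℚ) →ₗ[ℚ] (Y₀ → ℚ)))
    (hιeq : ∀ c (j : JJ c) (k : G) (a : Yc c → ℚ), a ∈ Ar c →
      ι c j (fun y => a (k • y)) = fun y => ι c j a (k • y))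
    (hind : ∀ c (f : JJ c → (Yc c → ℚ)), (∀ j, f j ∈ Ar c) → ∑ j, ι c j (f j) = 0 → ∀ j, f j = 0)
    (htop : (⨆ c, ⨆ j, (Ar c).map (ι c j)) = ⊤) :
    antiWeights (E := Y₀) ρ = ⨆ c : {c // Ar c ≤ antiWeights (E := Yc c) ρ}, ⨆ j, (Ar c.1).map (ι c.1 j) := by
  refine le_antisymm (fun u hu => ?_) (iSup_le fun c => iSup_le fun j => Submodule.map_le_iff_le_comap.2
    fun a ha => map_mem_antiWeights (ι c.1 j) (hιeq c.1 j) ha (c.2 ha))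
  obtain ⟨b, hb, rfl⟩ := exists_components_of_iSup_map_eq_top ι htop u
  refine Submodule.sum_mem _ fun c _ => Submodule.sum_mem _ fun j _ => ?_
  rcases le_symWeights_or_le_antiWeights (hcomm c) (hinv c) (hRst c) (hRirr c) with heven | hoddc
  · rw [eq_zero_of_le_symWeights hRst hRirr hsep ι hιeq hind hb hu heven j, map_zero]
    exact Submodule.zero_mem _
  · exact Submodule.mem_iSup_of_mem (p := fun c : {c // Ar c ≤ antiWeights (E := Yc c) ρ} =>
      ⨆ j, (Ar c.1).map (ι c.1 j)) ⟨c, hoddc⟩ (Submodule.mem_iSup_of_mem j (Submodule.mem_map_of_mem (hb c j)))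

/-- **`dim Anti(Y₀) = Σ_{c odd} |J_c|·dim A_c`** (the odd isotypic components are independent, gen 75 M1, and
`dim ⨆_j ι_{c,j}(A_c) = |J_c|·dim A_c`, E8). [cite: Kubota1965, §2 (p. 115)] [cite: Serre1977, §2.6] -/
theorem finrank_antiWeights_eq_sum_odd
    (hcomm : ∀ c (g : G) (y : Yc c), g • ρ • y = ρ • g • y) (hinv : ∀ c (y : Yc c), ρ • ρ • y = y)
    (hRst : ∀ c (k : G) (a : Yc c → ℚ), a ∈ Ar c → (fun y => a (k • y)) ∈ Ar c)
    (hRirr : ∀ c (W : Submodule ℚ (Yc c → ℚ)), W ≤ Ar c → W ≠ ⊥ →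
      (∀ (k : G) (f : Yc c → ℚ), f ∈ W → (fun y => f (k • y)) ∈ W) → W = Ar c)
    (hsep : ∀ c c' (L : (Yc c → ℚ) →ₗ[ℚ] (Yc c' → ℚ)), c ≠ c' → Ar c ≠ ⊥ → (∀ a ∈ Ar c, L a ∈ Ar c') →
      (∀ a ∈ Ar c, L a = 0 → a = 0) →
      (∀ (k : G) (a : Yc c → ℚ), a ∈ Ar c → L (fun y => a (k • y)) = fun y => L a (k • y)) → False)
    (ι : ∀ c, JJ c → ((Yc c → ℚ) →ₗ[ℚ] (Y₀ → ℚ)))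
    (hιeq : ∀ c (j : JJ c) (k : G) (a : Yc c → ℚ), a ∈ Ar c →
      ι c j (fun y => a (k • y)) = fun y => ι c j a (k • y))
    (hind : ∀ c (f : JJ c → (Yc c → ℚ)), (∀ j, f j ∈ Ar c) → ∑ j, ι c j (f j) = 0 → ∀ j, f j = 0)
    (htop : (⨆ c, ⨆ j, (Ar c).map (ι c j)) = ⊤) :
    Module.finrank ℚ (antiWeights (E := Y₀) ρ) =
      ∑ c : {c // Ar c ≤ antiWeights (E := Yc c) ρ}, Fintype.card (JJ c.1) * Module.finrank ℚ (Ar c.1) := by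
  rw [antiWeights_eq_iSup_odd hcomm hinv hRst hRirr hsep ι hιeq hind htop]
  have hP : iSupIndep fun c : {c // Ar c ≤ antiWeights (E := Yc c) ρ} => ⨆ j, (Ar c.1).map (ι c.1 j) :=
    (iSupIndep_iSup_map_of_classes hRst hRirr hsep ι hιeq hind).comp Subtype.val_injective
  rw [(finrank_iSup_eq_sum_finrank_iff_iSupIndep _).2 hP]
  exact Finset.sum_congr rfl fun c _ => finrank_iSup_map_eq_card_mul (ι c.1)
    (injOn_of_jointly_independent (ι c.1) (hind c.1)) (iSupIndep_map_of_jointly_independent (ι c.1) (hind c.1))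

end Components

end Summit.HodgeConjecture.CorCM.IrrOdd

end
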